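import Summits.AnomalousDissipation.AnomalousDissipation.Theorems.BaireTransferDefs
import Summits.AnomalousDissipation.AnomalousDissipation.Theorems.BaireTransferDenseLoudDesignerForcesErgodicGlue
import Summits.AnomalousDissipation.AnomalousDissipation.Theorems.BaireTransferDenseLoudDesignerForcesStubBirkhoffMeans
import Summits.AnomalousDissipation.AnomalousDissipation.Theorems.BaireTransferDenseLoudDesignerForcesStubTrajectoryPowerBudget

/-!
# `DenseLoudLerayHopfForces` (stmt-AnomalousDissipation-1149): loud trajectories and loud invariant measures of an
# NS phase are Leray–Hopf witnesses

Support file (`--supports stmt-AnomalousDissipation-1149`) wiring the Leray–Hopf item `DenseLoudLerayHopfForces`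
(rung A1 of crux #2 of route `BaireTransfer`) to the REGISTERED RESIDUAL STUBS of the line
`ergodic-budget-selection-closing` of the crux `DenseLoudDesignerForces` (stmt-AnomalousDissipation-1143), over the
landed line vocabulary `Theorems/BaireTransferDenseLoudDesignerForcesErgodicLine.lean` (`Hsp`, `rep`, `enstrophyObs`,
`energyAvg`, `dissipAvg`, `IsNSPhase`, `IsInvariantMeasure`, `IsHyperbolicMeasure`, `hypLoudSet`):

* §1 TRAJECTORY DICTIONARY.  The classical trajectory `(u, p)` of a point `x` of an NS phase `(K, φ)`
  (`IsNSPhase.trajectory`) is a global Leray–Hopf solution from its time-zero slice (classical ⇒ Leray–Hopf on the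
  convex time set `[0, ∞)`, Robinson–Rodrigo–Sadowski 2016 Thm. 6.5 = `isLerayHopfOn_of_convex`), and its `limsup`
  functionals `meanEnergy u`, `meanDissipation ν u` (Doering–Foias 2002 §2, `Literature/Analysis/FluidPDE/ZerothLaw.lean`)
  ARE the `limsup`s of the trajectory time means `energyAvg φ x`, `dissipAvg ν φ x` (the spectral enstrophy only sees
  the a.e.-class, `eGradNormSq_congr_ae`).  On an NS phase the dissipation time means are bounded (compactness of `K`,
  continuity of the enstrophy observable), so `limsup` is honest: eventually `energyAvg ≤ E` gives `meanEnergy u ≤ E`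
  and frequently `dissipAvg ≥ ε` gives `meanDissipation ν u ≥ ε`.
* §2 LOUD TRAJECTORIES ⇒ THE ITEM.  The level-`j` set of Stub 1′ `stub_denseLoudHyperbolicTrajectories` of the line
  (lead c3, skeleton of 2026-08-16T14:23Z) WITHOUT its hyperbolicity clause is contained in `lhLoudSet S E ε j` with the
  SAME budgets; hence "dense loud trajectories of NS phases" implies `DenseLoudLerayHopfForces`, and so does the stub
  verbatim (`denseLoudLerayHopfForces_of_denseLoudHyperbolicTrajectories`).
* §3 LOUD INVARIANT MEASURES ⇒ THE ITEM.  A loud invariant probability measure on an NS phase (ensemble energy `≤ E`,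
  ensemble dissipation `≥ ε`, force of `L²`-size `≤ F`) yields, by the landed Birkhoff budgets (`stub_birkhoffMeans`),
  the landed trajectory power budget (`stub_trajectoryPowerBudget`) and BUDGET SELECTION (`budget_selection`), a point
  whose trajectory is a Leray–Hopf witness with budgets `(16F²E²/ε², ε/2)` — NO hyperbolicity, NO closing lemma, NO
  periodicity.  Hence Stub 1 `stub_denseHyperbolicLoudMeasures` (lead c1, skeleton v5) implies the item as well
  (`denseLoudLerayHopfForces_of_denseHyperbolicLoudMeasures`), with the line glue's `j`-uniform budget inflation on a ball.

Upshot for the planner: rung A1 = `DenseLoudLerayHopfForces` sits below the residual physics stub of EVERY current form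
of the ergodic line, and strictly below the crux only through the chaotic hypothesis (H) + closing; it closes by one
line the day either residual stub lands.  Nothing here closes an item; no definition is introduced (the H-free sets are
written inline).

References: Doering–Foias, JFM 467 (2002) §2; Robinson–Rodrigo–Sadowski (CUP 2016) Thm. 6.5; Foias–Manley–Rosa–Temam
(CUP 2001) Ch. IV §2, Ch. V §1 (time vs ensemble averages); the route file `Theses/BaireTransfer.lean` (items 1143, 1149).
-/

-- `Summit.<Summit>.<Problem>` is the tree's mandated summit-side namespace (CONVENTIONS §2); for this
-- single-conjunct summit the two coincide, so the duplicate is deliberate.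
set_option linter.dupNamespace false

noncomputable section

open scoped BigOperators Topology ENNReal InnerProductSpace
open Filter Set Function MeasureTheory

namespace Summit.AnomalousDissipation.AnomalousDissipation.Theorems.DenseLoudLerayHopfForces

open Literature.Analysis.FunctionSpaces Literature.Analysis.FunctionSpaces.Torus
open Literature.Analysis.FluidPDE Literature.Analysis.FluidPDE.Torus
open Summit.AnomalousDissipation.AnomalousDissipation.Theses.BaireTransfer
open Summit.AnomalousDissipation.AnomalousDissipation.Theorems.DenseLoudDesignerForces.Negative
open Summit.AnomalousDissipation.AnomalousDissipation.Theorems.DenseLoudDesignerForces.Ergodic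

/-! ## §1 Trajectory dictionary: classical trajectories of an NS phase are Leray–Hopf witnesses -/

section Trajectories

variable {ν : ℝ} {F : (UnitAddTorus (Fin 3)) → (EuclideanSpace ℝ (Fin 3))} {K : Set Hsp} {φ : ℝ → Hsp → Hsp}

/-- A classical solution of the forced Navier–Stokes system on the half-line `[0, ∞)` is a global Leray–Hopf solution
from its time-zero slice `u 0` (Robinson–Rodrigo–Sadowski 2016, Thm. 6.5, in the tree as
`IsClassicalNSSolutionOn.isLerayHopfOn_of_convex`, applied on the convex time set `Ici 0 ⊇ [0, T]`). -/
theorem isGlobalLerayHopf_of_isClassicalNSSolutionOn_Ici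
    {f : ℝ → (UnitAddTorus (Fin 3)) → (EuclideanSpace ℝ (Fin 3))}
    {u : ℝ → (UnitAddTorus (Fin 3)) → (EuclideanSpace ℝ (Fin 3))} {p : ℝ → (UnitAddTorus (Fin 3)) → ℝ}
    (h : IsClassicalNSSolutionOn (Ici 0) ν f u p) : IsGlobalLerayHopf ν f (u 0) u :=
  fun _ hT => h.isLerayHopfOn_of_convex (convex_Ici 0) hT Icc_subset_Ici_self

/-- **Trajectory dictionary.**  For `x ∈ K` on an NS phase `(K, φ)` with steady force `F`, the classical trajectory
`(u, p)` of `x` (`IsNSPhase.trajectory`: `u(t)` represents `φ_t x` for `t ≥ 0`) has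
`meanEnergy u = limsup_T energyAvg φ x T` and `meanDissipation ν u = limsup_T dissipAvg ν φ x T`: for `T ≥ 0` the
Cesàro means coincide termwise (`‖φ_t x‖² = ∫‖u(t)‖²`, and the spectral enstrophy only sees the a.e.-class), and a
`limsup` at `+∞` only depends on the eventual values (Doering–Foias 2002 §2 functionals). -/
theorem exists_trajectory_means (hK : IsNSPhase ν F K φ) {x : Hsp} (hx : x ∈ K) :
    ∃ (u : ℝ → (UnitAddTorus (Fin 3)) → (EuclideanSpace ℝ (Fin 3))) (p : ℝ → (UnitAddTorus (Fin 3)) → ℝ),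
      IsClassicalNSSolutionOn (Ici 0) ν (fun _ => F) u p ∧ (∀ t : ℝ, 0 ≤ t → rep (φ t x) =ᵐ[volume] u t) ∧
        meanEnergy u = limsup (energyAvg φ x) atTop ∧
          meanDissipation ν u = limsup (dissipAvg ν φ x) atTop := by
  obtain ⟨u, p, hsol, hrep⟩ := hK.trajectory x hx
  refine ⟨u, p, hsol, hrep, ?_, ?_⟩
  · rw [meanEnergy_eq_longTimeAvgSup]
    unfold longTimeAvgSup
    refine limsup_congr ?_
    filter_upwards [eventually_ge_atTop (0 : ℝ)] with T hT
    unfold timeMean energyAvg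
    congr 1
    refine intervalIntegral.integral_congr fun t ht => ?_
    rw [uIcc_of_le hT] at ht
    exact (stub_trajectoryPowerBudget_aux_norm_sq (φ t x) (hrep t ht.1)).symm
  · unfold meanDissipation longTimeAvgSup
    refine limsup_congr ?_
    filter_upwards [eventually_ge_atTop (0 : ℝ)] with T hT
    unfold timeMean dissipAvg
    congr 1
    refine intervalIntegral.integral_congr fun t ht => ?_
    rw [uIcc_of_le hT] at ht
    show ν * (eGradNormSq (u t)).toReal = ν * enstrophyObs (φ t x)
    unfold enstrophyObs
    rw [Literature.Analysis.FluidPDE.eGradNormSq_congr_ae (hrep t ht.1)]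

/-- The trajectory time means of the energy are nonnegative for `T ≥ 0`. -/
theorem energyAvg_nonneg (φ : ℝ → Hsp → Hsp) (x : Hsp) {T : ℝ} (hT : 0 ≤ T) : 0 ≤ energyAvg φ x T :=
  mul_nonneg (inv_nonneg.2 hT) (intervalIntegral.integral_nonneg hT fun _ _ => sq_nonneg _)

/-- `limsup_T energyAvg φ x T ≤ E` as soon as `energyAvg φ x T ≤ E` eventually (the means are eventually
nonnegative, which is the coboundedness a real `limsup` needs). -/
theorem limsup_energyAvg_le {x : Hsp} {E : ℝ} (hE : ∀ᶠ T in atTop, energyAvg φ x T ≤ E) :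
    limsup (energyAvg φ x) atTop ≤ E :=
  limsup_le_of_le (isCoboundedUnder_le_of_eventually_le atTop
    ((eventually_ge_atTop (0 : ℝ)).mono fun _ hT => energyAvg_nonneg φ x hT)) hE

/-- **Bounded dissipation means on an NS phase.**  For `x ∈ K` and `ν ≥ 0` the dissipation time means
`dissipAvg ν φ x` are eventually bounded above (by `ν · sup_K enstrophyObs`: `K` is compact, the enstrophy observable
is continuous on `K`, and the trajectory stays in `K`), so their real `limsup` is not a junk value. -/
theorem isBoundedUnder_dissipAvg (hK : IsNSPhase ν F K φ) {x : Hsp} (hx : x ∈ K) (hν : 0 ≤ ν) :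
    IsBoundedUnder (· ≤ ·) atTop (dissipAvg ν φ x) := by
  obtain ⟨M, hM⟩ := hK.isCompact.exists_bound_of_continuousOn hK.enstrophy_continuousOn
  have hMK : ∀ v ∈ K, enstrophyObs v ≤ M := fun v hv => (le_abs_self _).trans ((Real.norm_eq_abs _) ▸ hM v hv)
  have hobs : ContinuousOn (fun t : ℝ => enstrophyObs (φ t x)) (Ici 0) :=
    stub_birkhoffMeans_aux_orbit_continuousOn hK hK.enstrophy_continuousOn hx
  refine isBoundedUnder_of_eventually_le (a := ν * M) ?_
  filter_upwards [eventually_gt_atTop (0 : ℝ)] with T hT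
  have hsub : uIcc 0 T ⊆ Ici 0 := by
    rw [uIcc_of_le hT.le]
    exact Icc_subset_Ici_self
  have hi : IntervalIntegrable (fun t : ℝ => ν * enstrophyObs (φ t x)) volume 0 T :=
    ((hobs.mono hsub).intervalIntegrable).const_mul ν
  have hle : ∫ t in (0 : ℝ)..T, ν * enstrophyObs (φ t x) ≤ ∫ _t in (0 : ℝ)..T, ν * M :=
    intervalIntegral.integral_mono_on hT.le hi intervalIntegrable_const fun t ht =>
      mul_le_mul_of_nonneg_left (hMK _ (hK.mapsTo t ht.1 hx)) hν
  unfold dissipAvg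
  calc T⁻¹ * ∫ t in (0 : ℝ)..T, ν * enstrophyObs (φ t x) ≤ T⁻¹ * ∫ _t in (0 : ℝ)..T, ν * M :=
        mul_le_mul_of_nonneg_left hle (inv_nonneg.2 hT.le)
    _ = ν * M := by
        rw [intervalIntegral.integral_const, smul_eq_mul, sub_zero, ← mul_assoc, inv_mul_cancel₀ hT.ne', one_mul]

/-- `ε ≤ limsup_T dissipAvg ν φ x T` as soon as `ε ≤ dissipAvg ν φ x T` frequently (`x ∈ K`, `ν ≥ 0`; boundedness
from `isBoundedUnder_dissipAvg`). -/
theorem le_limsup_dissipAvg (hK : IsNSPhase ν F K φ) {x : Hsp} (hx : x ∈ K) (hν : 0 ≤ ν) {ε : ℝ}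
    (hε : ∃ᶠ T in atTop, ε ≤ dissipAvg ν φ x T) : ε ≤ limsup (dissipAvg ν φ x) atTop :=
  le_limsup_of_frequently_le hε (isBoundedUnder_dissipAvg hK hx hν)

/-- **LOUD TRAJECTORY ⇒ LERAY–HOPF WITNESS (same budgets).**  On an NS phase `(K, φ)` of NS_ν(F), `ν ≥ 0`, a point
`x ∈ K` whose trajectory has eventually `energyAvg ≤ E` and frequently `dissipAvg ≥ ε` yields a global Leray–Hopf
solution `u` of NS_ν forced by the steady `F` (its own classical trajectory, datum `u 0`) with `meanEnergy u ≤ E` and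
`meanDissipation ν u ≥ ε`.  No hyperbolicity, invariant measure, closing or periodicity is involved. -/
theorem exists_isGlobalLerayHopf_of_loudTrajectory (hK : IsNSPhase ν F K φ) {x : Hsp} (hx : x ∈ K) (hν : 0 ≤ ν)
    {E ε : ℝ} (hE : ∀ᶠ T in atTop, energyAvg φ x T ≤ E) (hε : ∃ᶠ T in atTop, ε ≤ dissipAvg ν φ x T) :
    ∃ (u₀ : (UnitAddTorus (Fin 3)) → (EuclideanSpace ℝ (Fin 3)))
      (u : ℝ → (UnitAddTorus (Fin 3)) → (EuclideanSpace ℝ (Fin 3))),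
      IsGlobalLerayHopf ν (fun _ => F) u₀ u ∧ meanEnergy u ≤ E ∧ ε ≤ meanDissipation ν u := by
  obtain ⟨u, p, hsol, -, hEu, hDu⟩ := exists_trajectory_means hK hx
  exact ⟨u 0, u, isGlobalLerayHopf_of_isClassicalNSSolutionOn_Ici hsol, hEu.trans_le (limsup_energyAvg_le hE),
    (le_limsup_dissipAvg hK hx hν hε).trans_eq hDu.symm⟩

/-- **BIRKHOFF-GENERIC POINT ⇒ LERAY–HOPF WITNESS (limit budgets).**  If the trajectory time means of `x ∈ K`
CONVERGE, `energyAvg φ x → e` and `dissipAvg ν φ x → δ`, then the classical trajectory is a global Leray–Hopf witness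
with `meanEnergy u = e` and `meanDissipation ν u = δ` (a `limsup` of a convergent function is its limit). -/
theorem exists_isGlobalLerayHopf_of_tendsto (hK : IsNSPhase ν F K φ) {x : Hsp} (hx : x ∈ K) {e δ : ℝ}
    (he : Tendsto (energyAvg φ x) atTop (𝓝 e)) (hd : Tendsto (dissipAvg ν φ x) atTop (𝓝 δ)) :
    ∃ (u₀ : (UnitAddTorus (Fin 3)) → (EuclideanSpace ℝ (Fin 3)))
      (u : ℝ → (UnitAddTorus (Fin 3)) → (EuclideanSpace ℝ (Fin 3))),
      IsGlobalLerayHopf ν (fun _ => F) u₀ u ∧ meanEnergy u = e ∧ meanDissipation ν u = δ := by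
  obtain ⟨u, p, hsol, -, hEu, hDu⟩ := exists_trajectory_means hK hx
  exact ⟨u 0, u, isGlobalLerayHopf_of_isClassicalNSSolutionOn_Ici hsol, hEu.trans he.limsup_eq,
    hDu.trans hd.limsup_eq⟩

end Trajectories

/-! ## §2 Dense loud trajectories (Stub 1′ of the ergodic line, hyperbolicity dropped) imply the item -/

section LoudTrajectories

/-- **The level-`j` loud-trajectory set is inside `LHLOUD_j(S,E,ε)`** (same budgets): forces `c` carrying, at some
`ν ∈ (0, 1/(j+1))`, an NS phase of NS_ν(f_c) with a point whose trajectory has eventually `energyAvg ≤ E` and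
frequently `dissipAvg ≥ ε` — the set of Stub 1′ `stub_denseLoudHyperbolicTrajectories` of the line
`ergodic-budget-selection-closing` WITHOUT its hyperbolicity clause, written inline — belong to `lhLoudSet S E ε j`. -/
theorem loudTrajectorySet_subset_lhLoudSet (S : Finset (Fin 3 → ℤ)) (E ε : ℝ) (j : ℕ) :
    {c : ↥S → (EuclideanSpace ℂ (Fin 3)) | ∃ ν : ℝ, 0 < ν ∧ ν < 1 / ((j : ℝ) + 1) ∧
        ∃ (K : Set Hsp) (φ : ℝ → Hsp → Hsp), IsNSPhase ν (force S c) K φ ∧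
          ∃ x ∈ K, (∀ᶠ T in atTop, energyAvg φ x T ≤ E) ∧ (∃ᶠ T in atTop, ε ≤ dissipAvg ν φ x T)} ⊆
      lhLoudSet S E ε j := by
  rintro c ⟨ν, hν, hνj, K, φ, hK, x, hx, hE, hε⟩
  obtain ⟨u₀, u, hLH, hEu, hεu⟩ := exists_isGlobalLerayHopf_of_loudTrajectory hK hx hν.le hE hε
  exact ⟨ν, hν, hνj, u₀, u, hLH, hEu, hεu⟩

/-- The level-`j` set of Stub 1′ `stub_denseLoudHyperbolicTrajectories` VERBATIM (with the hyperbolicity clause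
"every invariant probability measure on the phase is hyperbolic") is inside `LHLOUD_j(S,E,ε)`: drop the clause. -/
theorem hypLoudTrajectorySet_subset_lhLoudSet (S : Finset (Fin 3 → ℤ)) (E ε : ℝ) (j : ℕ) :
    {c : ↥S → (EuclideanSpace ℂ (Fin 3)) | ∃ ν : ℝ, 0 < ν ∧ ν < 1 / ((j : ℝ) + 1) ∧
        ∃ (K : Set Hsp) (φ : ℝ → Hsp → Hsp), IsNSPhase ν (force S c) K φ ∧
          (∀ μ : Measure Hsp, IsInvariantMeasure K φ μ → IsHyperbolicMeasure ν (force S c) φ μ) ∧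
            ∃ x ∈ K, (∀ᶠ T in atTop, energyAvg φ x T ≤ E) ∧ (∃ᶠ T in atTop, ε ≤ dissipAvg ν φ x T)} ⊆
      lhLoudSet S E ε j := by
  rintro c ⟨ν, hν, hνj, K, φ, hK, -, x, hx, hE, hε⟩
  exact loudTrajectorySet_subset_lhLoudSet S E ε j ⟨ν, hν, hνj, K, φ, hK, x, hx, hE, hε⟩

/-- **DENSE LOUD TRAJECTORIES ⇒ `DenseLoudLerayHopfForces`.**  If for every finite stock `S₀` there are `S ⊇ S₀`,
budgets `E`, `ε > 0` and a non-empty open `U ⊆ P_S` in which, at every level `j`, the forces carrying an NS phase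
with a loud trajectory (eventually `energyAvg ≤ E`, frequently `dissipAvg ≥ ε`) at some `ν < 1/(j+1)` are dense,
then the item holds with the same `(S, E, ε, U)` (closure is monotone). -/
theorem denseLoudLerayHopfForces_of_denseLoudTrajectories
    (h : ∀ S₀ : Finset (Fin 3 → ℤ), ∃ S : Finset (Fin 3 → ℤ), S₀ ⊆ S ∧ ∃ (E ε : ℝ), 0 < ε ∧
      ∃ U : Set (↥S → (EuclideanSpace ℂ (Fin 3))), IsOpen U ∧ U.Nonempty ∧ ∀ j : ℕ,
        U ⊆ closure {c : ↥S → (EuclideanSpace ℂ (Fin 3)) | ∃ ν : ℝ, 0 < ν ∧ ν < 1 / ((j : ℝ) + 1) ∧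
          ∃ (K : Set Hsp) (φ : ℝ → Hsp → Hsp), IsNSPhase ν (force S c) K φ ∧
            ∃ x ∈ K, (∀ᶠ T in atTop, energyAvg φ x T ≤ E) ∧ (∃ᶠ T in atTop, ε ≤ dissipAvg ν φ x T)}) :
    DenseLoudLerayHopfForces := by
  refine denseLoudLerayHopfForces_iff.2 fun S₀ => ?_
  obtain ⟨S, hS, E, ε, hε, U, hUo, hUne, hU⟩ := h S₀
  exact ⟨S, hS, E, ε, hε, U, hUo, hUne, fun j =>
    (hU j).trans (closure_mono (loudTrajectorySet_subset_lhLoudSet S E ε j))⟩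

/-- **Stub 1′ `stub_denseLoudHyperbolicTrajectories` of the line `ergodic-budget-selection-closing` (registered
signature, verbatim as hypothesis) ⇒ `DenseLoudLerayHopfForces`.**  The day the stub lands the item closes by
`denseLoudLerayHopfForces_of_denseLoudHyperbolicTrajectories stub_denseLoudHyperbolicTrajectories`; the hyperbolicity
clause is not used. -/
theorem denseLoudLerayHopfForces_of_denseLoudHyperbolicTrajectories
    (h : ∀ S₀ : Finset (Fin 3 → ℤ), ∃ S : Finset (Fin 3 → ℤ), S₀ ⊆ S ∧ ∃ (E ε : ℝ), 0 < ε ∧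
      ∃ U : Set (↥S → (EuclideanSpace ℂ (Fin 3))), IsOpen U ∧ U.Nonempty ∧ ∀ j : ℕ,
        U ⊆ closure {c : ↥S → (EuclideanSpace ℂ (Fin 3)) | ∃ ν : ℝ, 0 < ν ∧ ν < 1 / ((j : ℝ) + 1) ∧
          ∃ (K : Set Hsp) (φ : ℝ → Hsp → Hsp), IsNSPhase ν (force S c) K φ ∧
            (∀ μ : Measure Hsp, IsInvariantMeasure K φ μ → IsHyperbolicMeasure ν (force S c) φ μ) ∧
              ∃ x ∈ K, (∀ᶠ T in atTop, energyAvg φ x T ≤ E) ∧ (∃ᶠ T in atTop, ε ≤ dissipAvg ν φ x T)}) :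
    DenseLoudLerayHopfForces := by
  refine denseLoudLerayHopfForces_iff.2 fun S₀ => ?_
  obtain ⟨S, hS, E, ε, hε, U, hUo, hUne, hU⟩ := h S₀
  exact ⟨S, hS, E, ε, hε, U, hUo, hUne, fun j =>
    (hU j).trans (closure_mono (hypLoudTrajectorySet_subset_lhLoudSet S E ε j))⟩

end LoudTrajectories

/-! ## §3 Loud invariant measures (Stub 1 of the ergodic line, hyperbolicity dropped) imply the item -/

section LoudMeasures

/-- **LOUD INVARIANT MEASURE ⇒ LERAY–HOPF WITNESS (budgets `16F²E²/ε²`, `ε/2`).**  On an NS phase `(K, φ)` of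
NS_ν(F) with an invariant probability measure `μ` of ensemble energy `≤ E` and ensemble dissipation `≥ ε > 0`, and
`‖F‖_{L²} ≤ F₀` (`F₀, E > 0`), some point of `K` has a classical trajectory which is a global Leray–Hopf solution `u`
of NS_ν(F) with `meanEnergy u ≤ 16F₀²E²/ε²` and `meanDissipation ν u ≥ ε/2`.  Proof: the landed Birkhoff budgets with
the pointwise power budget (`birkhoffPowerBudget_of stub_birkhoffMeans stub_trajectoryPowerBudget`), BUDGET SELECTION
(`budget_selection`: the cell `{En ≤ 16F₀²E²/ε², D ≥ ε/2}` has positive measure), a point of the cell with converging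
time means, and `exists_isGlobalLerayHopf_of_tendsto`.  No hyperbolicity and no closing lemma. -/
theorem exists_isGlobalLerayHopf_of_loudMeasure {ν : ℝ} {F : (UnitAddTorus (Fin 3)) → (EuclideanSpace ℝ (Fin 3))}
    {K : Set Hsp} {φ : ℝ → Hsp → Hsp} {μ : Measure Hsp} (hK : IsNSPhase ν F K φ) (hμ : IsInvariantMeasure K φ μ)
    {F₀ E ε : ℝ} (hF : Real.sqrt (∫ y, ‖F y‖ ^ 2) ≤ F₀) (hF₀ : 0 < F₀) (hE : 0 < E) (hε : 0 < ε)
    (hEn : ensembleEnergy μ ≤ E) (hD : ε ≤ ensembleDissipation ν μ) :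
    ∃ (u₀ : (UnitAddTorus (Fin 3)) → (EuclideanSpace ℝ (Fin 3)))
      (u : ℝ → (UnitAddTorus (Fin 3)) → (EuclideanSpace ℝ (Fin 3))),
      IsGlobalLerayHopf ν (fun _ => F) u₀ u ∧ meanEnergy u ≤ 16 * F₀ ^ 2 * E ^ 2 / ε ^ 2 ∧
        ε / 2 ≤ meanDissipation ν u := by
  haveI := hμ.prob
  obtain ⟨En, D, hEm, hDm, hE0, hEi, hDi, hIE, hID, hpow, hlim⟩ :=
    birkhoffPowerBudget_of stub_birkhoffMeans stub_trajectoryPowerBudget hK hμ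
  set B : Set Hsp := {x | En x ≤ 16 * F₀ ^ 2 * E ^ 2 / ε ^ 2 ∧ ε / 2 ≤ D x} with hBdef
  have hpow' : ∀ x, D x ≤ F₀ * Real.sqrt (En x) := fun x =>
    (hpow x).trans (mul_le_mul_of_nonneg_right hF (Real.sqrt_nonneg _))
  have hsel := budget_selection μ hDm hEm hE0 hF₀ hE hε hpow' hDi hEi (by rw [hID]; exact hD)
    (by rw [hIE]; exact hEn)
  have hμB : μ B ≠ 0 := by
    have hpos : 0 < ENNReal.ofReal (ε ^ 2 / (16 * F₀ ^ 2 * E)) := ENNReal.ofReal_pos.2 (by positivity)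
    exact (lt_of_lt_of_le hpos hsel).ne'
  -- a point of the budget cell, on `K`, with converging time means
  obtain ⟨x, ⟨hxE, hxD⟩, hxK, hxlim⟩ : ∃ x ∈ B, x ∈ K ∧
      (Tendsto (energyAvg φ x) atTop (𝓝 (En x)) ∧ Tendsto (dissipAvg ν φ x) atTop (𝓝 (D x))) := by
    obtain ⟨x, hx, h⟩ := Measure.exists_mem_of_measure_ne_zero_of_ae hμB (ae_restrict_of_ae (hμ.ae_mem.and hlim))
    exact ⟨x, hx, h.1, h.2⟩
  obtain ⟨u₀, u, hLH, hEu, hDu⟩ := exists_isGlobalLerayHopf_of_tendsto hK hxK hxlim.1 hxlim.2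
  exact ⟨u₀, u, hLH, hEu.trans_le hxE, hxD.trans_eq hDu.symm⟩

/-- **The level-`j` loud-measure set on a unit ball is inside an `LHLOUD_j` with `j`-UNIFORM inflated budgets.**
For `c'` within distance `1` of `c₀` one has `‖f_{c'}‖₂ ≤ F₀ := √(#S)(‖c₀‖+1) + 1` (`sqrt_forceEnergy_le`), so a loud
invariant measure of NS_ν(f_{c'}) with budgets `(E, ε)` gives `c' ∈ lhLoudSet S (16F₀²(max E 1)²/ε²) (ε/2) j`.  The set
on the left is `hypLoudSet S E ε j` WITHOUT its hyperbolicity clause, written inline. -/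
theorem ball_inter_loudMeasureSet_subset_lhLoudSet (S : Finset (Fin 3 → ℤ)) (c₀ : ↥S → (EuclideanSpace ℂ (Fin 3)))
    (E : ℝ) {ε : ℝ} (hε : 0 < ε) (j : ℕ) :
    Metric.ball c₀ 1 ∩ {c : ↥S → (EuclideanSpace ℂ (Fin 3)) | ∃ ν : ℝ, 0 < ν ∧ ν < 1 / ((j : ℝ) + 1) ∧
        ∃ (K : Set Hsp) (φ : ℝ → Hsp → Hsp) (μ : Measure Hsp), IsNSPhase ν (force S c) K φ ∧
          IsInvariantMeasure K φ μ ∧ ensembleEnergy μ ≤ E ∧ ε ≤ ensembleDissipation ν μ} ⊆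
      lhLoudSet S (16 * (Real.sqrt (S.card * (‖c₀‖ + 1) ^ 2) + 1) ^ 2 * (max E 1) ^ 2 / ε ^ 2) (ε / 2) j := by
  rintro c ⟨hcball, ν, hν, hνj, K, φ, μ, hK, hμ, hEn, hD⟩
  have hF : Real.sqrt (∫ y, ‖force S c y‖ ^ 2) ≤ Real.sqrt (S.card * (‖c₀‖ + 1) ^ 2) + 1 := by
    have hdist : dist c c₀ < 1 := by rwa [Metric.mem_ball] at hcball
    have := sqrt_forceEnergy_le hdist
    linarith
  have hF₀ : 0 < Real.sqrt (S.card * (‖c₀‖ + 1) ^ 2) + 1 := by positivity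
  have hE₁ : 0 < max E 1 := lt_of_lt_of_le one_pos (le_max_right _ _)
  obtain ⟨u₀, u, hLH, hEu, hDu⟩ :=
    exists_isGlobalLerayHopf_of_loudMeasure hK hμ hF hF₀ hE₁ hε (hEn.trans (le_max_left _ _)) hD
  exact ⟨ν, hν, hνj, u₀, u, hLH, hEu, hDu⟩

/-- **DENSE LOUD INVARIANT MEASURES ⇒ `DenseLoudLerayHopfForces`.**  If for every finite stock `S₀` there are
`S ⊇ S₀`, budgets `E`, `ε > 0` and a non-empty open `U ⊆ P_S` in which, at every level `j`, the forces carrying an NS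
phase with a loud invariant probability measure (ensemble energy `≤ E`, ensemble dissipation `≥ ε`) at some
`ν < 1/(j+1)` are dense, then the item holds — with the window shrunk to a unit ball `U ∩ B(c₀, 1)` and the budgets
inflated `j`-uniformly to `(16F₀²(max E 1)²/ε², ε/2)`, `F₀ = √(#S)(‖c₀‖+1) + 1` (density survives intersection with
an open set, `IsOpen.inter_closure`). -/
theorem denseLoudLerayHopfForces_of_denseLoudMeasures
    (h : ∀ S₀ : Finset (Fin 3 → ℤ), ∃ S : Finset (Fin 3 → ℤ), S₀ ⊆ S ∧ ∃ (E ε : ℝ), 0 < ε ∧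
      ∃ U : Set (↥S → (EuclideanSpace ℂ (Fin 3))), IsOpen U ∧ U.Nonempty ∧ ∀ j : ℕ,
        U ⊆ closure {c : ↥S → (EuclideanSpace ℂ (Fin 3)) | ∃ ν : ℝ, 0 < ν ∧ ν < 1 / ((j : ℝ) + 1) ∧
          ∃ (K : Set Hsp) (φ : ℝ → Hsp → Hsp) (μ : Measure Hsp), IsNSPhase ν (force S c) K φ ∧
            IsInvariantMeasure K φ μ ∧ ensembleEnergy μ ≤ E ∧ ε ≤ ensembleDissipation ν μ}) :
    DenseLoudLerayHopfForces := by
  refine denseLoudLerayHopfForces_iff.2 fun S₀ => ?_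
  obtain ⟨S, hS, E, ε, hε, U, hUo, ⟨c₀, hc₀⟩, hdense⟩ := h S₀
  have hU'o : IsOpen (U ∩ Metric.ball c₀ 1) := hUo.inter Metric.isOpen_ball
  refine ⟨S, hS, 16 * (Real.sqrt (S.card * (‖c₀‖ + 1) ^ 2) + 1) ^ 2 * (max E 1) ^ 2 / ε ^ 2, ε / 2,
    half_pos hε, U ∩ Metric.ball c₀ 1, hU'o, ⟨c₀, hc₀, Metric.mem_ball_self one_pos⟩, fun j => ?_⟩
  rintro c ⟨hcU, hcball⟩
  have h1 : c ∈ closure ((U ∩ Metric.ball c₀ 1) ∩ {c : ↥S → (EuclideanSpace ℂ (Fin 3)) | ∃ ν : ℝ, 0 < ν ∧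
      ν < 1 / ((j : ℝ) + 1) ∧ ∃ (K : Set Hsp) (φ : ℝ → Hsp → Hsp) (μ : Measure Hsp), IsNSPhase ν (force S c) K φ ∧
        IsInvariantMeasure K φ μ ∧ ensembleEnergy μ ≤ E ∧ ε ≤ ensembleDissipation ν μ}) :=
    hU'o.inter_closure ⟨⟨hcU, hcball⟩, hdense j hcU⟩
  refine closure_mono ?_ h1
  rintro c' ⟨⟨-, hc'ball⟩, hc'⟩
  exact ball_inter_loudMeasureSet_subset_lhLoudSet S c₀ E hε j ⟨hc'ball, hc'⟩

/-- **Stub 1 `stub_denseHyperbolicLoudMeasures` of the line `ergodic-budget-selection-closing` (registered signature,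
verbatim as hypothesis: windows for the loud-hyperbolic-measure sets `hypLoudSet`) ⇒ `DenseLoudLerayHopfForces`.**
The day the stub lands the item closes by
`denseLoudLerayHopfForces_of_denseHyperbolicLoudMeasures stub_denseHyperbolicLoudMeasures`; neither the hyperbolicity
nor the closing lemma (Stub 2′) is used. -/
theorem denseLoudLerayHopfForces_of_denseHyperbolicLoudMeasures
    (h : ∀ S₀ : Finset (Fin 3 → ℤ), ∃ S : Finset (Fin 3 → ℤ), S₀ ⊆ S ∧ ∃ (E ε : ℝ), 0 < ε ∧
      ∃ U : Set (↥S → (EuclideanSpace ℂ (Fin 3))), IsOpen U ∧ U.Nonempty ∧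
        ∀ j : ℕ, U ⊆ closure (hypLoudSet S E ε j)) :
    DenseLoudLerayHopfForces := by
  refine denseLoudLerayHopfForces_of_denseLoudMeasures fun S₀ => ?_
  obtain ⟨S, hS, E, ε, hε, U, hUo, hUne, hU⟩ := h S₀
  refine ⟨S, hS, E, ε, hε, U, hUo, hUne, fun j => (hU j).trans (closure_mono ?_)⟩
  rintro c ⟨ν, hν, hνj, K, φ, μ, hK, hμ, hEn, hD, -⟩
  exact ⟨ν, hν, hνj, K, φ, μ, hK, hμ, hEn, hD⟩

end LoudMeasures

/-! ## §4 Stub 1′ in its re-registered form (2026-08-16T14:45Z: chaotic hypothesis on the orbit closure) implies the item -/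

section LoudTrajectoriesOrbitClosure

/-- **Stub 1′ `stub_denseLoudHyperbolicTrajectories` as RE-REGISTERED by lead c3 (skeleton
`Cruxes/DenseLoudDesignerForces/Lines/ergodic_budget_selection_closing.lean` of 2026-08-16T14:45Z: the chaotic hypothesis
is asked only of the LOUD invariant probability measures carried by the closure of the forward orbit of the loud point, and
it comes AFTER `∃ x ∈ K`) ⇒ `DenseLoudLerayHopfForces`.**  The earlier adapter
`denseLoudLerayHopfForces_of_denseLoudHyperbolicTrajectories` matches the superseded 14:23Z signature only; this one is
verbatim for the current registration.  Proof: drop the hyperbolicity clause and apply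
`denseLoudLerayHopfForces_of_denseLoudTrajectories` (same `S, E, ε, U`); the day the stub lands the item closes by
`denseLoudLerayHopfForces_of_denseLoudHyperbolicTrajectories' stub_denseLoudHyperbolicTrajectories`. -/
theorem denseLoudLerayHopfForces_of_denseLoudHyperbolicTrajectories'
    (h : ∀ S₀ : Finset (Fin 3 → ℤ), ∃ S : Finset (Fin 3 → ℤ), S₀ ⊆ S ∧ ∃ (E ε : ℝ), 0 < ε ∧
      ∃ U : Set (↥S → (EuclideanSpace ℂ (Fin 3))), IsOpen U ∧ U.Nonempty ∧ ∀ j : ℕ,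
        U ⊆ closure {c : ↥S → (EuclideanSpace ℂ (Fin 3)) | ∃ ν : ℝ, 0 < ν ∧ ν < 1 / ((j : ℝ) + 1) ∧
          ∃ (K : Set Hsp) (φ : ℝ → Hsp → Hsp), IsNSPhase ν (force S c) K φ ∧
            ∃ x ∈ K, (∀ᶠ T in atTop, energyAvg φ x T ≤ E) ∧ (∃ᶠ T in atTop, ε ≤ dissipAvg ν φ x T) ∧
              ∀ μ : Measure Hsp, IsInvariantMeasure (closure ((fun t : ℝ => φ t x) '' Ici 0)) φ μ →
                ensembleEnergy μ ≤ E → ε ≤ ensembleDissipation ν μ → IsHyperbolicMeasure ν (force S c) φ μ}) :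
    DenseLoudLerayHopfForces := by
  refine denseLoudLerayHopfForces_of_denseLoudTrajectories fun S₀ => ?_
  obtain ⟨S, hS, E, ε, hε, U, hUo, hUne, hU⟩ := h S₀
  refine ⟨S, hS, E, ε, hε, U, hUo, hUne, fun j => (hU j).trans (closure_mono ?_)⟩
  rintro c ⟨ν, hν, hνj, K, φ, hK, x, hx, hE, hεx, -⟩
  exact ⟨ν, hν, hνj, K, φ, hK, x, hx, hE, hεx⟩

end LoudTrajectoriesOrbitClosure

end Summit.AnomalousDissipation.AnomalousDissipation.Theorems.DenseLoudLerayHopfForces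

end
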